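import Literature.NumberTheory.LFunctions.GranvilleSoundararajanLemma21
import Literature.NumberTheory.LFunctions.GranvilleSoundararajanKernel
import Literature.NumberTheory.LFunctions.GranvilleSoundararajanMeanSquare
import Literature.NumberTheory.LFunctions.GranvilleSoundararajanEulerProduct
import Literature.NumberTheory.LFunctions.GranvilleSoundararajanMainTerm
import Literature.NumberTheory.LFunctions.MertensFormula
import HarnessLib

/-!
# Granville–Soundararajan 2003, Theorem 1: the proof

DISCHARGE of the named fact
`Literature.NumberTheory.LFunctions.GranvilleSoundararajan.GranvilleSoundararajan2003_theorem1`
(A. Granville, K. Soundararajan, *Decay of mean values of multiplicative functions*, Canad. J. Math.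
55 (2003), Theorem 1 — the sharp form of Halász's theorem):
`x⁻¹|∑_{n≤x} f(n)| ≤ L(log(e^γ/L) + 12/7) + O(1/T + log log x/log x)`,
`L = (log x)⁻¹ max_{|y| ≤ 2T} |F(1+iy)|`, for multiplicative `f` with `|f| ≤ 1`, `x ≥ 3`, `T ≥ 1`.

The proof follows the paper (§§2–4) with the sharp constants throughout; its ingredients were
landed as separate files:
* `GranvilleSoundararajanLemma21` — Lemma 2.1 for multiplicative `f`;
* `GranvilleSoundararajanKernel` — (3.7) with the factor `2` (cut-off `α₀ = 1/log² x`);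
* `GranvilleSoundararajanMeanSquare` (with `…PrimeMeanSquare`, `…SmoothLogSums`,
  `…Decomposition`) — (3.8) with the sharp Lemma 3.2 for multiplicative `f`;
* `GranvilleSoundararajanEulerProduct` — `F = ∑ f̃(n) n^{-s}`, (4.1), (4.2), the supremum `L`;
* `GranvilleSoundararajanMainTerm` — the calculus (4.3)–(4.4) and `1 + log 2 + 1/(8e²) ≤ 12/7`;
* Mertens' formula `∏_{p≤x}(1-1/p)⁻¹ = e^γ log x + O(1)` (`mertens_formula`, tree) for
  `L ≤ e^γ + O(1/log x)`.
Regimes: bounded `x` and `L ≥ 1` are trivial (the left side is `≤ 1`); for `L < 1` the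
`α`-integral is split at `α₁ = min(1, 1/(L log x))` as in (4.3).

## Main result
- `GranvilleSoundararajan2003_theorem1_holds : GranvilleSoundararajan2003_theorem1`.

## References
- [GranvilleSoundararajan2003] A. Granville, K. Soundararajan, *Decay of mean values of
  multiplicative functions*, Canad. J. Math. 55 (2003), 1191–1230, Theorem 1 and §§2–4;
  arXiv math/9911246 pp. 1–8.
-/

noncomputable section

open Finset Real Complex MeasureTheory Set Filter

namespace Literature.NumberTheory.LFunctions

namespace GranvilleSoundararajan

open Halasz (S normSExp smoothCut mulLog)
open MellinPlancherel (psum)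
open Literature.NumberTheory.Sieve (ein ein_nonneg)

/-! ### The `α`-integration of the pointwise bound ((4.3) of the paper) -/

/-- **The `α`-integration (4.3)**: with `ℓ = log x`, `α₀ = 1/ℓ²`, `0 ≤ L_x < ℓ`,
`B(α) = min(L_x + (2α/T) e⁵ℓ, 1 + 1/α)`, `K(α) = (1 - e^{-2ℓα})/(2α)`, `m(α) = min(ℓ, 1/α)`, and
`α₁ = 1` if `L_x ≤ 1`, `α₁ = 1/L_x` otherwise: if `I(α) ≤ B K + C₇(B + √(m/α) + √m/√T + m²/T)` on
`[α₀, 1]` then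
`∫_{α₀}^1 I ≤ (L_x/2) Ein(2ℓα₁) + ℓ ∫_{2ℓα₁}^{2ℓ} (1-e^{-y})/y² dy + e⁵ℓ/T + (log ℓ)/2
  + C₇ (1 + 4 log ℓ + 2/√T + 2ℓ/T)`.
[cite: GranvilleSoundararajan2003, §4, (4.3)] -/
theorem alpha_integral_le {x T Lx C₇ : ℝ} (hx : 3 ≤ x) (hT : 1 ≤ T) (hLx0 : 0 ≤ Lx)
    (hLx : Lx < Real.log x) (hC₇ : 0 ≤ C₇) {I : ℝ → ℝ}
    (hIint : IntervalIntegrable I volume (1 / Real.log x ^ 2) 1)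
    (hI : ∀ α ∈ Set.Icc (1 / Real.log x ^ 2) 1,
      I α ≤ min (Lx + 2 * α / T * (Real.exp 5 * Real.log x)) (1 + 1 / α) *
          ((1 - Real.exp (-(2 * Real.log x * α))) / (2 * α)) +
        C₇ * (min (Lx + 2 * α / T * (Real.exp 5 * Real.log x)) (1 + 1 / α) +
          Real.sqrt (min (Real.log x) (1 / α) / α) + Real.sqrt (min (Real.log x) (1 / α)) / Real.sqrt T +
          (min (Real.log x) (1 / α)) ^ 2 / T)) :
    ∫ α in (1 / Real.log x ^ 2)..1, I α ≤
      Lx / 2 * ein (2 * Real.log x * (if Lx ≤ 1 then 1 else 1 / Lx)) +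
        Real.log x * (∫ y in (2 * Real.log x * (if Lx ≤ 1 then 1 else 1 / Lx))..(2 * Real.log x),
          (1 - Real.exp (-y)) / y ^ 2) +
        (Real.exp 5 * Real.log x / T + Real.log (Real.log x) / 2 +
          C₇ * (1 + 4 * Real.log (Real.log x) + 2 / Real.sqrt T + 2 * Real.log x / T)) := by
  set ℓ : ℝ := Real.log x with hℓ
  set α₀ : ℝ := 1 / ℓ ^ 2 with hα₀
  set α₁ : ℝ := (if Lx ≤ 1 then 1 else 1 / Lx) with hα₁
  set S₁ : ℝ := Real.exp 5 * ℓ with hS₁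
  set B : ℝ → ℝ := fun α => min (Lx + 2 * α / T * S₁) (1 + 1 / α) with hB
  set K : ℝ → ℝ := fun α => (1 - Real.exp (-(2 * ℓ * α))) / (2 * α) with hK
  set m : ℝ → ℝ := fun α => min ℓ (1 / α) with hm
  have hx0 : 0 < x := by linarith
  have hT0 : 0 < T := by linarith
  have hℓ1 : 1 ≤ ℓ := by
    rw [hℓ, Real.le_log_iff_exp_le hx0]
    exact le_trans (by have := Real.exp_one_lt_d9; linarith) hx
  have hℓ0 : 0 < ℓ := by linarith
  have hα₀0 : 0 < α₀ := by positivity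
  have hα₀1 : α₀ ≤ 1 := by rw [hα₀, div_le_one (by positivity)]; nlinarith
  have hα₀ℓ : α₀ ≤ 1 / ℓ := by rw [hα₀, div_le_div_iff₀ (by positivity) hℓ0]; nlinarith
  have hS₁0 : 0 ≤ S₁ := by positivity
  -- `α₁ ∈ [α₀, 1]`, `0 < α₁`
  have hα₁pos : 0 < α₁ := by
    rw [hα₁]; split_ifs with h
    · exact one_pos
    · push Not at h
      have : 0 < Lx := by linarith
      positivity
  have hα₁le : α₁ ≤ 1 := by
    rw [hα₁]; split_ifs with h
    · exact le_rfl
    · push Not at h; rw [div_le_one (by linarith)]; exact h.le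
  have hα₀α₁ : α₀ ≤ α₁ := by
    rw [hα₁]; split_ifs with h
    · exact hα₀1
    · push Not at h
      refine hα₀ℓ.trans ?_
      exact one_div_le_one_div_of_le (by linarith) hLx.le
  -- positivity of points of `[α₀, 1]`
  have hpos : ∀ {a : ℝ} {α : ℝ}, 0 < a → α ∈ Set.Icc a 1 → 0 < α := fun ha hα => ha.trans_le hα.1
  -- continuity on `[a, 1]`, `a > 0`
  have hcontK : ∀ {a : ℝ}, 0 < a → ContinuousOn K (Set.Icc a 1) := by
    intro a ha
    simp only [hK]
    exact (continuousOn_const.sub (by fun_prop)).div (continuousOn_const.mul continuousOn_id)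
      fun α hα => by have := hpos ha hα; positivity
  have hcontB : ∀ {a : ℝ}, 0 < a → ContinuousOn B (Set.Icc a 1) := by
    intro a ha
    simp only [hB]
    refine ContinuousOn.inf (by fun_prop) (continuousOn_const.add ?_)
    exact continuousOn_const.div continuousOn_id fun α hα => (hpos ha hα).ne'
  have hcontm : ∀ {a : ℝ}, 0 < a → ContinuousOn m (Set.Icc a 1) := fun ha => continuousOn_min_inv ha
  have hcontInv : ∀ {a : ℝ}, 0 < a → ContinuousOn (fun α : ℝ => 1 / α) (Set.Icc a 1) :=
    fun ha => continuousOn_const.div continuousOn_id fun α hα => (hpos ha hα).ne'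
  -- the pointwise facts on `[α₀, 1]`
  have hm0 : ∀ {α : ℝ}, 0 < α → 0 ≤ m α := fun hα => le_min hℓ0.le (by positivity)
  have hmle : ∀ {α : ℝ}, 0 < α → m α ≤ 1 / α := fun _ => min_le_right _ _
  have hK0 : ∀ {α : ℝ}, 0 < α → 0 ≤ K α := by
    intro α hα
    simp only [hK]
    refine div_nonneg ?_ (by positivity)
    rw [sub_nonneg, Real.exp_le_one_iff]; nlinarith
  have hKle : ∀ {α : ℝ}, 0 < α → K α ≤ 1 / (2 * α) := by
    intro α hα
    simp only [hK]
    exact div_le_div_of_nonneg_right (by linarith [Real.exp_pos (-(2 * ℓ * α))]) (by positivity)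
  have h2αK : ∀ {α : ℝ}, 0 < α → 2 * α * K α ≤ 1 := by
    intro α hα
    simp only [hK]
    rw [mul_div_cancel₀ _ (by positivity : 2 * α ≠ 0)]
    linarith [Real.exp_pos (-(2 * ℓ * α))]
  have hB0 : ∀ {α : ℝ}, 0 < α → 0 ≤ B α := fun hα => le_min (by positivity) (by positivity)
  have hB1 : ∀ α, B α ≤ Lx + 2 * α / T * S₁ := fun α => min_le_left _ _
  have hB2 : ∀ α, B α ≤ 1 + 1 / α := fun α => min_le_right _ _
  -- (a) the main part `∫ B K`
  have hIK : ∀ {a b : ℝ}, 0 < a → a ≤ b → b ≤ 1 → IntervalIntegrable (fun α => B α * K α) volume a b := by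
    intro a b ha hab hb1
    exact (((hcontB ha).mul (hcontK ha)).mono (Set.Icc_subset_Icc_right hb1)).intervalIntegrable_of_Icc hab
  have hmain1 : ∫ α in α₀..α₁, B α * K α ≤ Lx / 2 * ein (2 * ℓ * α₁) + S₁ / T := by
    have hle : ∀ α ∈ Set.Icc α₀ α₁, B α * K α ≤ Lx * K α + S₁ / T := by
      intro α hα
      have hαp : 0 < α := hα₀0.trans_le hα.1
      calc B α * K α ≤ (Lx + 2 * α / T * S₁) * K α := mul_le_mul_of_nonneg_right (hB1 α) (hK0 hαp)
        _ = Lx * K α + S₁ / T * (2 * α * K α) := by ring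
        _ ≤ Lx * K α + S₁ / T * 1 := by gcongr; exact h2αK hαp
        _ = Lx * K α + S₁ / T := by ring
    have hi2 : IntervalIntegrable (fun α => Lx * K α + S₁ / T) volume α₀ α₁ :=
      (((hcontK hα₀0).mono (Set.Icc_subset_Icc_right hα₁le)).intervalIntegrable_of_Icc hα₀α₁ |>.const_mul Lx).add
        intervalIntegrable_const
    calc ∫ α in α₀..α₁, B α * K α ≤ ∫ α in α₀..α₁, (Lx * K α + S₁ / T) :=
          intervalIntegral.integral_mono_on hα₀α₁ (hIK hα₀0 hα₀α₁ hα₁le) hi2 hle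
      _ = Lx * (∫ α in α₀..α₁, K α) + (α₁ - α₀) * (S₁ / T) := by
          rw [intervalIntegral.integral_add ?_ intervalIntegrable_const, intervalIntegral.integral_const_mul,
            intervalIntegral.integral_const, smul_eq_mul]
          exact ((hcontK hα₀0).mono (Set.Icc_subset_Icc_right hα₁le)).intervalIntegrable_of_Icc hα₀α₁ |>.const_mul Lx
      _ ≤ Lx * (ein (2 * ℓ * α₁) / 2) + 1 * (S₁ / T) := by
          gcongr
          · simp only [hK]
            rw [integral_K_eq hℓ0 hα₀0 hα₀α₁]
            have := ein_nonneg (by positivity : 0 ≤ 2 * ℓ * α₀)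
            linarith
          · linarith
      _ = Lx / 2 * ein (2 * ℓ * α₁) + S₁ / T := by ring
  have hmain2 : ∫ α in α₁..1, B α * K α ≤ Real.log ℓ / 2 +
      ℓ * ∫ y in (2 * ℓ * α₁)..(2 * ℓ * 1), (1 - Real.exp (-y)) / y ^ 2 := by
    have hle : ∀ α ∈ Set.Icc α₁ 1, B α * K α ≤ 1 / (2 * α) + K α / α := by
      intro α hα
      have hαp : 0 < α := hα₁pos.trans_le hα.1
      calc B α * K α ≤ (1 + 1 / α) * K α := mul_le_mul_of_nonneg_right (hB2 α) (hK0 hαp)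
        _ = K α + K α / α := by ring
        _ ≤ 1 / (2 * α) + K α / α := by gcongr; exact hKle hαp
    have hi1 : IntervalIntegrable (fun α : ℝ => 1 / (2 * α)) volume α₁ 1 := by
      refine (continuousOn_const.div (continuousOn_const.mul continuousOn_id) fun α hα => ?_).intervalIntegrable
      rw [Set.uIcc_of_le hα₁le] at hα
      exact mul_ne_zero two_ne_zero (ne_of_gt (hα₁pos.trans_le hα.1))
    have hi2 : IntervalIntegrable (fun α => K α / α) volume α₁ 1 :=
      ((hcontK hα₁pos).div continuousOn_id fun α hα => (hpos hα₁pos hα).ne').intervalIntegrable_of_Icc hα₁le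
    calc ∫ α in α₁..1, B α * K α ≤ ∫ α in α₁..1, (1 / (2 * α) + K α / α) :=
          intervalIntegral.integral_mono_on hα₁le (hIK hα₁pos hα₁le le_rfl) (hi1.add hi2) hle
      _ = (∫ α in α₁..1, 1 / (2 * α)) + ∫ α in α₁..1, K α / α := intervalIntegral.integral_add hi1 hi2
      _ ≤ Real.log ℓ / 2 + ℓ * ∫ y in (2 * ℓ * α₁)..(2 * ℓ * 1), (1 - Real.exp (-y)) / y ^ 2 := by
          refine add_le_add ?_ (le_of_eq ?_)
          · have hrw : ∫ α in α₁..1, 1 / (2 * α) = (1 / 2) * ∫ α in α₁..1, 1 / α := by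
              rw [← intervalIntegral.integral_const_mul]
              refine intervalIntegral.integral_congr fun α _ => ?_
              ring
            rw [hrw, integral_one_div_of_pos hα₁pos one_pos]
            have hlog : Real.log (1 / α₁) ≤ Real.log ℓ := by
              refine Real.log_le_log (by positivity) ?_
              rw [hα₁]; split_ifs with h
              · rw [div_one]; exact hℓ1
              · rw [one_div_one_div]; exact hLx.le
            linarith
          · simp only [hK]
            exact integral_K_div_eq hℓ0 hα₁pos hα₁le
  -- (b)–(e) the error parts
  have herrB : ∫ α in α₀..1, B α ≤ 1 + 2 * Real.log ℓ := by
    calc ∫ α in α₀..1, B α ≤ ∫ α in α₀..1, (1 + 1 / α) :=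
          intervalIntegral.integral_mono_on hα₀1 ((hcontB hα₀0).intervalIntegrable_of_Icc hα₀1)
            (intervalIntegrable_const.add ((hcontInv hα₀0).intervalIntegrable_of_Icc hα₀1))
            fun α _ => hB2 α
      _ ≤ 1 + 2 * Real.log ℓ := integral_one_add_inv_le hℓ1
  have herr1 : ∫ α in α₀..1, Real.sqrt (m α / α) ≤ 2 * Real.log ℓ := by
    have hle : ∀ α ∈ Set.Icc α₀ 1, Real.sqrt (m α / α) ≤ 1 / α := by
      intro α hα
      have hαp : 0 < α := hα₀0.trans_le hα.1
      rw [Real.sqrt_le_left (by positivity)]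
      calc m α / α ≤ (1 / α) / α := div_le_div_of_nonneg_right (hmle hαp) hαp.le
        _ = (1 / α) ^ 2 := by ring
    calc ∫ α in α₀..1, Real.sqrt (m α / α) ≤ ∫ α in α₀..1, 1 / α :=
          intervalIntegral.integral_mono_on hα₀1
            ((((hcontm hα₀0).div continuousOn_id fun α hα => (hpos hα₀0 hα).ne').sqrt).intervalIntegrable_of_Icc hα₀1)
            ((hcontInv hα₀0).intervalIntegrable_of_Icc hα₀1) hle
      _ = 2 * Real.log ℓ := integral_inv_alpha hℓ1
  have herr2 : ∫ α in α₀..1, Real.sqrt (m α) / Real.sqrt T ≤ 2 / Real.sqrt T := by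
    have hsT : 0 < Real.sqrt T := Real.sqrt_pos.mpr hT0
    have hle : ∀ α ∈ Set.Icc α₀ 1, Real.sqrt (m α) ≤ α ^ (-(1 / 2) : ℝ) := by
      intro α hα
      have hαp : 0 < α := hα₀0.trans_le hα.1
      calc Real.sqrt (m α) ≤ Real.sqrt (1 / α) := Real.sqrt_le_sqrt (hmle hαp)
        _ = α ^ (-(1 / 2) : ℝ) := by
            rw [Real.sqrt_eq_rpow, one_div, Real.inv_rpow hαp.le, ← Real.rpow_neg hαp.le]
    rw [intervalIntegral.integral_div]
    refine div_le_div_of_nonneg_right ?_ hsT.le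
    calc ∫ α in α₀..1, Real.sqrt (m α) ≤ ∫ α in α₀..1, α ^ (-(1 / 2) : ℝ) :=
          intervalIntegral.integral_mono_on hα₀1 ((hcontm hα₀0).sqrt.intervalIntegrable_of_Icc hα₀1)
            (intervalIntegral.intervalIntegrable_rpow' (by norm_num)) hle
      _ ≤ 2 := integral_rpow_neg_half_le hℓ1
  have herr3 : ∫ α in α₀..1, (m α) ^ 2 / T ≤ 2 * ℓ / T := by
    rw [intervalIntegral.integral_div]
    exact div_le_div_of_nonneg_right (integral_min_sq_le hℓ1) hT0.le
  -- integrate the pointwise bound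
  set R : ℝ → ℝ := fun α => B α * K α + C₇ * (B α + Real.sqrt (m α / α) + Real.sqrt (m α) / Real.sqrt T +
    (m α) ^ 2 / T) with hR
  have hcontR : ContinuousOn R (Set.Icc α₀ 1) := by
    simp only [hR]
    refine ((hcontB hα₀0).mul (hcontK hα₀0)).add (continuousOn_const.mul ?_)
    refine (((hcontB hα₀0).add ?_).add ?_).add ?_
    · exact ((hcontm hα₀0).div continuousOn_id fun α hα => (hpos hα₀0 hα).ne').sqrt
    · exact (hcontm hα₀0).sqrt.div_const _
    · exact ((hcontm hα₀0).pow 2).div_const _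
  have hIR : ∫ α in α₀..1, I α ≤ ∫ α in α₀..1, R α :=
    intervalIntegral.integral_mono_on hα₀1 hIint (hcontR.intervalIntegrable_of_Icc hα₀1) fun α hα => by
      simp only [hR, hB, hK, hm, hS₁]; exact hI α hα
  -- split `∫ R`
  have hiBK := hIK hα₀0 hα₀1 le_rfl
  have hiB : IntervalIntegrable B volume α₀ 1 := (hcontB hα₀0).intervalIntegrable_of_Icc hα₀1
  have hi1 : IntervalIntegrable (fun α => Real.sqrt (m α / α)) volume α₀ 1 :=
    (((hcontm hα₀0).div continuousOn_id fun α hα => (hpos hα₀0 hα).ne').sqrt).intervalIntegrable_of_Icc hα₀1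
  have hi2 : IntervalIntegrable (fun α => Real.sqrt (m α) / Real.sqrt T) volume α₀ 1 :=
    ((hcontm hα₀0).sqrt.div_const _).intervalIntegrable_of_Icc hα₀1
  have hi3 : IntervalIntegrable (fun α => (m α) ^ 2 / T) volume α₀ 1 :=
    (((hcontm hα₀0).pow 2).div_const _).intervalIntegrable_of_Icc hα₀1
  have hRsplit : ∫ α in α₀..1, R α = (∫ α in α₀..1, B α * K α) +
      C₇ * ((∫ α in α₀..1, B α) + (∫ α in α₀..1, Real.sqrt (m α / α)) +
        (∫ α in α₀..1, Real.sqrt (m α) / Real.sqrt T) + ∫ α in α₀..1, (m α) ^ 2 / T) := by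
    simp only [hR]
    rw [intervalIntegral.integral_add hiBK ((((hiB.add hi1).add hi2).add hi3).const_mul C₇),
      intervalIntegral.integral_const_mul, intervalIntegral.integral_add ((hiB.add hi1).add hi2) hi3,
      intervalIntegral.integral_add (hiB.add hi1) hi2, intervalIntegral.integral_add hiB hi1]
  have hBKsplit : ∫ α in α₀..1, B α * K α = (∫ α in α₀..α₁, B α * K α) + ∫ α in α₁..1, B α * K α :=
    (intervalIntegral.integral_add_adjacent_intervals (hIK hα₀0 hα₀α₁ hα₁le) (hIK hα₁pos hα₁le le_rfl)).symm
  rw [mul_one] at hmain2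
  have hsT0 : 0 ≤ 2 / Real.sqrt T := by positivity
  calc ∫ α in α₀..1, I α ≤ ∫ α in α₀..1, R α := hIR
    _ = (∫ α in α₀..α₁, B α * K α) + (∫ α in α₁..1, B α * K α) +
          C₇ * ((∫ α in α₀..1, B α) + (∫ α in α₀..1, Real.sqrt (m α / α)) +
            (∫ α in α₀..1, Real.sqrt (m α) / Real.sqrt T) + ∫ α in α₀..1, (m α) ^ 2 / T) := by
        rw [hRsplit, hBKsplit]
    _ ≤ (Lx / 2 * ein (2 * ℓ * α₁) + S₁ / T) +
          (Real.log ℓ / 2 + ℓ * ∫ y in (2 * ℓ * α₁)..(2 * ℓ), (1 - Real.exp (-y)) / y ^ 2) +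
          C₇ * ((1 + 2 * Real.log ℓ) + 2 * Real.log ℓ + 2 / Real.sqrt T + 2 * ℓ / T) := by
        gcongr
    _ = Lx / 2 * ein (2 * ℓ * α₁) + ℓ * (∫ y in (2 * ℓ * α₁)..(2 * ℓ), (1 - Real.exp (-y)) / y ^ 2) +
          (S₁ / T + Real.log ℓ / 2 + C₇ * (1 + 4 * Real.log ℓ + 2 / Real.sqrt T + 2 * ℓ / T)) := by ring
    _ = _ := by simp only [hS₁, hα₁, hℓ]

/-! ### Theorem 1 -/

/-- `e^γ < 2` (`γ < 2/3 < log 2`). [folklore] -/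
theorem exp_eulerMascheroni_lt_two : Real.exp Real.eulerMascheroniConstant < 2 := by
  have h1 := Real.eulerMascheroniConstant_lt_two_thirds
  have h2 := Real.log_two_gt_d9
  calc Real.exp Real.eulerMascheroniConstant < Real.exp (Real.log 2) := Real.exp_lt_exp.mpr (by linarith)
    _ = 2 := Real.exp_log (by norm_num)

/-- The error bookkeeping of the main regime: with `ℓ = log x ≥ log 3`, `λ = log log 3 ≤ log ℓ`,
`T ≥ 1`, `C₇ ≥ 0`,
`(2Ψ + log ℓ + 3 + |C₁|)/ℓ ≤ C (1/T + log ℓ/ℓ)`, `Ψ = e⁵ℓ/T + (log ℓ)/2 + C₇(1 + 4 log ℓ + 2/√T + 2ℓ/T)`,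
`C = 2e⁵ + 2 + 12 C₇ + (6C₇ + 3 + |C₁|)/λ`. [folklore] -/
theorem error_bookkeeping {ℓ lam T C₇ C₁ : ℝ} (hlam : 0 < lam) (hℓ : 1 ≤ ℓ) (hlamℓ : lam ≤ Real.log ℓ)
    (hT : 1 ≤ T) (hC₇ : 0 ≤ C₇) :
    (2 * (Real.exp 5 * ℓ / T + Real.log ℓ / 2 + C₇ * (1 + 4 * Real.log ℓ + 2 / Real.sqrt T + 2 * ℓ / T)) +
        Real.log ℓ + 3 + |C₁|) / ℓ ≤
      (2 * Real.exp 5 + 2 + 12 * C₇ + (6 * C₇ + 3 + |C₁|) / lam) * (1 / T + Real.log ℓ / ℓ) := by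
  have hℓ0 : 0 < ℓ := by linarith
  have hT0 : 0 < T := by linarith
  set E : ℝ := 1 / T + Real.log ℓ / ℓ with hE
  have hlog0 : 0 < Real.log ℓ := hlam.trans_le hlamℓ
  have hℓE : ℓ * E = ℓ / T + Real.log ℓ := by rw [hE]; field_simp
  have hE1 : ℓ / T ≤ ℓ * E := by rw [hℓE]; linarith
  have hℓT : 0 ≤ ℓ / T := by positivity
  have hE2 : Real.log ℓ ≤ ℓ * E := by rw [hℓE]; linarith
  have hE3 : 1 ≤ Real.log ℓ / lam := by rw [le_div_iff₀ hlam]; linarith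
  have hE4 : (1 : ℝ) ≤ (1 / lam) * (ℓ * E) := by
    calc (1 : ℝ) ≤ Real.log ℓ / lam := hE3
      _ = (1 / lam) * Real.log ℓ := by ring
      _ ≤ (1 / lam) * (ℓ * E) := mul_le_mul_of_nonneg_left hE2 (by positivity)
  have hsT : 1 ≤ Real.sqrt T := by rw [Real.le_sqrt (by norm_num) hT0.le]; linarith
  have hE5 : 2 / Real.sqrt T ≤ 2 := by
    rw [div_le_iff₀ (by positivity)]; linarith
  rw [div_le_iff₀ hℓ0]
  -- bound the numerator by `C · E · ℓ`
  have hlamE : 0 ≤ (1 / lam) * (ℓ * E) := by positivity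
  have key : 2 * (Real.exp 5 * ℓ / T + Real.log ℓ / 2 + C₇ * (1 + 4 * Real.log ℓ + 2 / Real.sqrt T + 2 * ℓ / T)) +
      Real.log ℓ + 3 + |C₁| ≤
      (2 * Real.exp 5 + 2 + 12 * C₇ + (6 * C₇ + 3 + |C₁|) / lam) * (ℓ * E) := by
    have e5 : 0 ≤ Real.exp 5 := (Real.exp_pos _).le
    have t1 : Real.exp 5 * ℓ / T ≤ Real.exp 5 * (ℓ * E) := by
      rw [mul_div_assoc]; exact mul_le_mul_of_nonneg_left hE1 e5
    have t2 : C₇ * (1 + 4 * Real.log ℓ + 2 / Real.sqrt T + 2 * ℓ / T) ≤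
        C₇ * ((1 / lam) * (ℓ * E) + 4 * (ℓ * E) + 2 * ((1 / lam) * (ℓ * E)) + 2 * (ℓ * E)) := by
      refine mul_le_mul_of_nonneg_left ?_ hC₇
      have : 2 * ℓ / T = 2 * (ℓ / T) := by ring
      rw [this]
      linarith [mul_le_mul_of_nonneg_left hE1 (by norm_num : (0:ℝ) ≤ 2)]
    have t3 : 3 + |C₁| ≤ (3 + |C₁|) * ((1 / lam) * (ℓ * E)) := by
      have := mul_le_mul_of_nonneg_left hE4 (by positivity : 0 ≤ 3 + |C₁|)
      linarith
    have hexp : (2 * Real.exp 5 + 2 + 12 * C₇ + (6 * C₇ + 3 + |C₁|) / lam) * (ℓ * E) =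
        2 * (Real.exp 5 * (ℓ * E)) + 2 * (ℓ * E) +
          2 * (C₇ * ((1 / lam) * (ℓ * E) + 4 * (ℓ * E) + 2 * ((1 / lam) * (ℓ * E)) + 2 * (ℓ * E))) +
          (3 + |C₁|) * ((1 / lam) * (ℓ * E)) := by ring
    rw [hexp]
    linarith
  calc _ ≤ (2 * Real.exp 5 + 2 + 12 * C₇ + (6 * C₇ + 3 + |C₁|) / lam) * (ℓ * E) := key
    _ = (2 * Real.exp 5 + 2 + 12 * C₇ + (6 * C₇ + 3 + |C₁|) / lam) * E * ℓ := by ring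

set_option maxHeartbeats 400000 in
/-- **Granville–Soundararajan 2003, Theorem 1** (the sharp Halász theorem), PROVED:
for multiplicative `f` with `|f| ≤ 1`, `x ≥ 3`, `T ≥ 1`,
`x⁻¹|∑_{n ≤ x} f(n)| ≤ L(log(e^γ/L) + 12/7) + C(1/T + log log x/log x)` with an absolute `C`,
`L = (log x)⁻¹ max_{|y|≤2T} |F(1+iy)|`. [cite: GranvilleSoundararajan2003, Theorem 1] -/
theorem GranvilleSoundararajan2003_theorem1_holds : GranvilleSoundararajan2003_theorem1 := by
  obtain ⟨C₁, hC₁⟩ := exists_norm_S_mul_log_le_integral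
  obtain ⟨C₇, hC₇0, hC₇⟩ := exists_inner_integral_le_sharp
  obtain ⟨C_M, hC_M⟩ := Mertens.mertens_formula
  set CM : ℝ := max C_M 0 with hCM
  have hCM0 : 0 ≤ CM := le_max_right _ _
  set lam : ℝ := Real.log (Real.log 3) with hlam
  have hlog3 : 1 < Real.log 3 := by
    rw [Real.lt_log_iff_exp_lt (by norm_num)]; have := Real.exp_one_lt_d9; linarith
  have hlam0 : 0 < lam := Real.log_pos hlog3
  set CR2 : ℝ := 2 * Real.exp 5 + 2 + 12 * C₇ + (6 * C₇ + 3 + |C₁|) / lam with hCR2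
  have hCR20 : 0 ≤ CR2 := by positivity
  set Lmax : ℝ := 2 + CM with hLmax
  set M₀ : ℝ := Lmax * Real.log Lmax with hM₀
  have hM₀0 : 0 ≤ M₀ := mul_nonneg (by positivity) (Real.log_nonneg (by linarith))
  set μ₀ : ℝ := lam / (4 * CM + 4) with hμ₀
  have hμ₀0 : 0 < μ₀ := by positivity
  refine ⟨CR2 + (1 + M₀) / μ₀, fun f hf hfb x T hx hT => ?_⟩
  set ℓ : ℝ := Real.log x with hℓ
  set Lx : ℝ := maxModulus (⇑f) x T with hLx
  have hx0 : 0 < x := by linarith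
  have hx1 : 1 ≤ x := by linarith
  have hT0 : 0 < T := by linarith
  have hℓ3 : Real.log 3 ≤ ℓ := Real.log_le_log (by norm_num) hx
  have hℓ1 : 1 ≤ ℓ := by linarith
  have hℓ0 : 0 < ℓ := by linarith
  have hloglam : lam ≤ Real.log ℓ := Real.log_le_log (by linarith) hℓ3
  have hlogℓ0 : 0 < Real.log ℓ := hlam0.trans_le hloglam
  have hSdef : (∑ n ∈ Icc 1 ⌊x⌋₊, f n) = S (⇑f) x := rfl
  rw [hSdef]
  have hSx : ‖S (⇑f) x‖ / x ≤ 1 := by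
    rw [div_le_one hx0]; exact Halasz.norm_S_le' hfb hx0.le
  have hLx0 : 0 ≤ Lx := maxModulus_nonneg hfb x hT0.le
  have heγ := exp_eulerMascheroni_lt_two
  have hLxle : Lx ≤ 2 * ℓ + CM := by
    have h1 := maxModulus_le_prod hfb x hT0.le
    have h2 := (abs_le.mp (hC_M x (by linarith))).2
    have h3 : C_M ≤ CM := le_max_left _ _
    have h4 : Real.exp Real.eulerMascheroniConstant * Real.log x ≤ 2 * ℓ := by
      rw [hℓ]; exact mul_le_mul_of_nonneg_right heγ.le hℓ0.le
    linarith
  set L : ℝ := Lx / ℓ with hL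
  have hL0 : 0 ≤ L := div_nonneg hLx0 hℓ0.le
  have hLℓ : L * ℓ = Lx := by rw [hL]; field_simp
  have herr0 : 0 ≤ 1 / T + Real.log ℓ / ℓ := by positivity
  have hCfin0 : 0 ≤ CR2 + (1 + M₀) / μ₀ := by positivity
  by_cases hX : ℓ < 4 * CM + 4
  · -- bounded `x`: the left side is `≤ 1`, the main term `≥ -M₀`, the error term `≥ 1 + M₀`
    have hLle : L ≤ Lmax := by
      rw [hL, div_le_iff₀ hℓ0, hLmax]
      have : CM * 1 ≤ CM * ℓ := mul_le_mul_of_nonneg_left hℓ1 hCM0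
      linarith
    have hmain := mainTerm_ge_neg hL0 hLle (by linarith : 1 ≤ Lmax)
    have herrμ : μ₀ ≤ 1 / T + Real.log ℓ / ℓ := by
      have h1 : μ₀ ≤ Real.log ℓ / ℓ := by
        rw [hμ₀, div_le_div_iff₀ (by positivity) hℓ0]
        have e1 : lam * ℓ ≤ lam * (4 * CM + 4) := mul_le_mul_of_nonneg_left hX.le hlam0.le
        have e2 : lam * (4 * CM + 4) ≤ Real.log ℓ * (4 * CM + 4) :=
          mul_le_mul_of_nonneg_right hloglam (by positivity)
        linarith
      have h2 : (0:ℝ) ≤ 1 / T := by positivity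
      linarith
    have hkey : 1 + M₀ ≤ (CR2 + (1 + M₀) / μ₀) * (1 / T + Real.log ℓ / ℓ) := by
      have h1 : (1 + M₀) / μ₀ * μ₀ ≤ (1 + M₀) / μ₀ * (1 / T + Real.log ℓ / ℓ) :=
        mul_le_mul_of_nonneg_left herrμ (by positivity)
      rw [div_mul_cancel₀ _ hμ₀0.ne'] at h1
      have h3 : 0 ≤ CR2 * (1 / T + Real.log ℓ / ℓ) := by positivity
      nlinarith
    rw [hM₀] at hkey
    linarith
  · push Not at hX
    by_cases hLbig : ℓ ≤ Lx
    · -- `L ≥ 1`: the main term alone is `≥ 1`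
      have hL1 : 1 ≤ L := by rw [hL, le_div_iff₀ hℓ0]; linarith
      have hL94 : L ≤ 9 / 4 := by
        rw [hL, div_le_iff₀ hℓ0]
        linarith
      have hmain := one_le_mainTerm hL1 hL94
      have : 0 ≤ (CR2 + (1 + M₀) / μ₀) * (1 / T + Real.log ℓ / ℓ) := by positivity
      linarith
    · -- the main regime `L < 1`
      push Not at hLbig
      have hL1 : L < 1 := by rw [hL, div_lt_one hℓ0]; exact hLbig
      -- Lemma 2.1 and (3.7)
      have h21 := hC₁ (⇑f) (fun m n hmn => hf.map_mul_of_coprime hmn) hfb x hx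
      have h37 := integral_normSExp_le_sharp (g := ⇑f) hfb hx
      rw [← hℓ] at h21 h37
      -- the inner integral as a function of `α`
      have hα₀0 : 0 < 1 / ℓ ^ 2 := by positivity
      have hα₀1 : 1 / ℓ ^ 2 ≤ 1 := by rw [div_le_one (by positivity)]; nlinarith
      set Iα : ℝ → ℝ := fun α => ∫ u in Set.Ioc (Real.log 2) ℓ,
        ‖psum (mulLog (⇑f) ⌊x⌋₊) (Real.exp u)‖ * Real.exp (-((1 + 2 * α) * u)) with hIα
      have hIpt : ∀ α ∈ Set.Icc (1 / ℓ ^ 2) 1,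
          Iα α ≤ min (Lx + 2 * α / T * (Real.exp 5 * ℓ)) (1 + 1 / α) *
              ((1 - Real.exp (-(2 * ℓ * α))) / (2 * α)) +
            C₇ * (min (Lx + 2 * α / T * (Real.exp 5 * ℓ)) (1 + 1 / α) +
              Real.sqrt (min ℓ (1 / α) / α) + Real.sqrt (min ℓ (1 / α)) / Real.sqrt T +
              (min ℓ (1 / α)) ^ 2 / T) := by
        intro α hα
        have hαp : 0 < α := hα₀0.trans_le hα.1
        have hBwin : ∀ y : ℝ, |y| ≤ T → ‖LSeries (smoothCut (⇑f) ⌊x⌋₊) (1 + α + y * I)‖ ≤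
            min (Lx + 2 * α / T * (Real.exp 5 * ℓ)) (1 + 1 / α) := fun y hy =>
          le_min (by rw [hLx, hℓ]; exact norm_F_shift_le f hf hfb hx hT0 hαp hy)
            (norm_LSeries_smoothCut_le_one_add_inv hfb ⌊x⌋₊ hαp y)
        have hBnn : 0 ≤ min (Lx + 2 * α / T * (Real.exp 5 * ℓ)) (1 + 1 / α) :=
          le_min (by positivity) (by positivity)
        have h := hC₇ f hf hfb x hx T hT α hαp hα.2 _ hBnn hBwin
        have hxexp : x ^ (-(2 * α)) = Real.exp (-(2 * ℓ * α)) := by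
          rw [Real.rpow_def_of_pos hx0, hℓ]; congr 1; ring
        rw [hxexp, ← hℓ] at h
        exact h
      have hIint : IntervalIntegrable Iα volume (1 / ℓ ^ 2) 1 := by
        rw [intervalIntegrable_iff_integrableOn_Ioc_of_le hα₀1]
        have hK := (Halasz.integrable_kernel (g := ⇑f) hfb ⌊x⌋₊ hx1 hα₀0.le).integral_prod_left
        rw [← hℓ] at hK
        rw [hIα]
        exact hK
      have hA := alpha_integral_le (x := x) hx hT hLx0 (by rw [← hℓ]; exact hLbig) hC₇0
        (by rw [← hℓ]; exact hIint) (by rw [← hℓ]; exact hIpt)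
      rw [← hℓ] at hA
      -- name the main and error parts of the bound
      obtain ⟨MAIN, ERR, hMAIN, hERR, hA'⟩ : ∃ MAIN ERR : ℝ,
          MAIN = Lx / 2 * ein (2 * ℓ * (if Lx ≤ 1 then 1 else 1 / Lx)) +
            ℓ * (∫ y in (2 * ℓ * (if Lx ≤ 1 then 1 else 1 / Lx))..(2 * ℓ), (1 - Real.exp (-y)) / y ^ 2) ∧
          ERR = Real.exp 5 * ℓ / T + Real.log ℓ / 2 +
            C₇ * (1 + 4 * Real.log ℓ + 2 / Real.sqrt T + 2 * ℓ / T) ∧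
          (∫ α in (1 / ℓ ^ 2)..1, Iα α) ≤ MAIN + ERR := ⟨_, _, rfl, rfl, hA⟩
      have hdouble : (∫ α in Set.Ioc (1 / ℓ ^ 2) 1, ∫ u in Set.Ioc (Real.log 2) ℓ,
          ‖psum (mulLog (⇑f) ⌊x⌋₊) (Real.exp u)‖ * Real.exp (-((1 + 2 * α) * u))) =
          ∫ α in (1 / ℓ ^ 2)..1, Iα α := (intervalIntegral.integral_of_le hα₀1).symm
      rw [hdouble] at h37
      -- the main term
      have hmainR2 : 2 * MAIN / ℓ ≤ L * (Real.log (Real.exp Real.eulerMascheroniConstant / L) + 12 / 7) := by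
        rw [hMAIN]
        by_cases hc : Lx ≤ 1
        · rw [if_pos hc, mul_one, intervalIntegral.integral_same, mul_zero, add_zero]
          rcases hLx0.eq_or_lt with h0 | hpos
          · -- `Lx = 0`
            have hL00 : L = 0 := by rw [hL, ← h0, zero_div]
            rw [← h0, hL00]; simp
          · have hLpos : 0 < L := by rw [hL]; positivity
            have h := mainTerm_caseA hLpos hℓ1 (by rw [hLℓ]; exact hc)
            have heq : 2 * (Lx / 2 * ein (2 * ℓ)) / ℓ = L * ein (2 * ℓ) := by rw [hL]; field_simp
            rw [heq]; exact h
        · push Not at hc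
          rw [if_neg (not_le.mpr hc)]
          have hLpos : 0 < L := by rw [hL]; positivity
          have hLxpos : 0 < Lx := by linarith
          have h := mainTerm_caseB hLpos hL1 hℓ1 (by rw [hLℓ]; exact hc)
          have h2L : 2 * ℓ * (1 / Lx) = 2 / L := by rw [hL]; field_simp
          rw [h2L]
          have heq : 2 * (Lx / 2 * ein (2 / L) + ℓ * ∫ y in (2 / L)..(2 * ℓ), (1 - Real.exp (-y)) / y ^ 2) / ℓ =
              L * ein (2 / L) + 2 * ∫ y in (2 / L)..(2 * ℓ), (1 - Real.exp (-y)) / y ^ 2 := by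
            rw [hL]; field_simp
          rw [heq]; exact h
      have herrR2 : (2 * ERR + Real.log ℓ + 3 + |C₁|) / ℓ ≤ CR2 * (1 / T + Real.log ℓ / ℓ) := by
        rw [hERR]; exact error_bookkeeping (C₁ := C₁) hlam0 hℓ1 hloglam hT hC₇0
      -- combine
      have hnum : ‖S (⇑f) x‖ * ℓ ≤ (2 * MAIN + (2 * ERR + Real.log ℓ + 3 + |C₁|)) * x := by
        have hC1 : C₁ * x ≤ |C₁| * x := mul_le_mul_of_nonneg_right (le_abs_self _) hx0.le
        have h2 : x * (∫ u in Real.log 2..ℓ, normSExp (⇑f) u) ≤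
            x * (2 * (∫ α in (1 / ℓ ^ 2)..1, Iα α) + (Real.log ℓ + 3)) :=
          mul_le_mul_of_nonneg_left h37 hx0.le
        have h3 : x * (2 * (∫ α in (1 / ℓ ^ 2)..1, Iα α) + (Real.log ℓ + 3)) ≤
            x * (2 * (MAIN + ERR) + (Real.log ℓ + 3)) :=
          mul_le_mul_of_nonneg_left (by linarith) hx0.le
        have h4 : x * (2 * (MAIN + ERR) + (Real.log ℓ + 3)) + |C₁| * x =
            (2 * MAIN + (2 * ERR + Real.log ℓ + 3 + |C₁|)) * x := by ring
        linarith
      have htot : ‖S (⇑f) x‖ / x ≤ 2 * MAIN / ℓ + (2 * ERR + Real.log ℓ + 3 + |C₁|) / ℓ := by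
        rw [← add_div, div_le_div_iff₀ hx0 hℓ0]
        exact hnum
      have hextra : 0 ≤ (1 + M₀) / μ₀ * (1 / T + Real.log ℓ / ℓ) := by positivity
      calc ‖S (⇑f) x‖ / x ≤ 2 * MAIN / ℓ + (2 * ERR + Real.log ℓ + 3 + |C₁|) / ℓ := htot
        _ ≤ L * (Real.log (Real.exp Real.eulerMascheroniConstant / L) + 12 / 7) +
              CR2 * (1 / T + Real.log ℓ / ℓ) := add_le_add hmainR2 herrR2
        _ ≤ L * (Real.log (Real.exp Real.eulerMascheroniConstant / L) + 12 / 7) +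
              (CR2 + (1 + M₀) / μ₀) * (1 / T + Real.log ℓ / ℓ) := by
            rw [add_mul]; linarith

end GranvilleSoundararajan

end Literature.NumberTheory.LFunctions
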